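import Summits.Ventures.AbcSig.Levels.N2984T1
import Summits.Ventures.AbcSig.Levels.N2984T2
import Summits.Ventures.AbcSig.Levels.N2984S2

/-!
# Venture AbcSig — GENERATED level file, level 2984 (AGGREGATOR of 3 part files)

HONEST FRAMING. As in the part files `N2984P<i>.lean` (same generator run, same certified level file
`N2984.engine1.json`, sha256 `a9a22587e3fa0950ab2ce0d38be90f200b4fba5e848a19ef14dc06568447441f`): this file only concatenates the orbit lists and the part summaries into
`level2984Orbits`, `level2984_wellformed`, `level2984_sieve` (the shapes the row templates consume). The split exists because the
tree's files are ≤ 400 lines. Union of residual exponents ≥ 7: [7, 11]; orbits not eliminable by the sieve: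
none. No Diophantine statement is made here; no claim on ABC or any summit.
-/

namespace Summit.Ventures.AbcSig

/-- All newform orbits of level 2984 (concatenation of the parts, engine order). -/
def level2984Orbits : List OrbitData :=
  level2984OrbitsT1 ++ level2984OrbitsT2 ++ level2984OrbitsS2

/-- Every listed entry is at an odd prime not dividing 2984. -/
theorem level2984_wellformed :
    ∀ o ∈ level2984Orbits, ∀ e ∈ o.coeffs, e.ell.Prime ∧ e.ell ≠ 2 ∧ ¬ e.ell ∣ 2984 := by
  unfold level2984Orbits
  exact List.forall_mem_append.2 ⟨List.forall_mem_append.2 ⟨level2984_wellformedT1, level2984_wellformedT2⟩, level2984_wellformedS2⟩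

/-- **Level 2984 summary.** For a prime exponent `n ≥ 7`, every orbit of level 2984 is sieve-eliminated by the
kernel certificates of the part files, except that the row's predicate `X` is assumed for: orbit_2984_1 if n ∈ [11], orbit_2984_2 if n ∈ [7], orbit_2984_3 if n ∈ [7]. -/
theorem level2984_sieve (n : ℕ) (hn : n.Prime) (hmin : 7 ≤ n) (X : OrbitData → Prop)
    (h_orbit_2984_1 : n ∈ ([11] : List ℕ) → X orbit_2984_1)
    (h_orbit_2984_2 : n ∈ ([7] : List ℕ) → X orbit_2984_2)
    (h_orbit_2984_3 : n ∈ ([7] : List ℕ) → X orbit_2984_3) :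
    ∀ o ∈ level2984Orbits, (∀ e ∈ o.coeffs, e.ell.Prime ∧ e.ell ≠ 2 ∧ ¬ e.ell ∣ 2984) ∧ (o.Eliminated bs04Allowed n ∨ X o) := by
  unfold level2984Orbits
  exact List.forall_mem_append.2 ⟨List.forall_mem_append.2 ⟨(level2984_sieveT1 n hn hmin X h_orbit_2984_1 h_orbit_2984_2), (level2984_sieveT2 n hn hmin X h_orbit_2984_3)⟩, (level2984_sieveS2 n hn hmin X)⟩

end Summit.Ventures.AbcSig
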